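import Summits.ValiantsHypothesis.ValiantsHypothesis.Theses.ForgivenCollisions

/-!
# ForgivenCollisions — `Assembly` (item stmt-ValiantsHypothesis-11574)

The rank-1 assembly item of route `ForgivenCollisions`:
`UniformLaw → GradedLaw → FirstRung → MonotoneLaw → GradedToUniform → MonotoneEndpoint →
OrderedLaw → DepthThreeRung → SyndromeRepresentative → CounterRepresentative → SyndromeUpperBound →
PurePowerAnchor → CoeffAgreement → ValiantsHypothesis`.

Only `UniformLaw` is load-bearing, and the argument is pure logic over proved tree facts (it is the
route's sorry-free deciding theorem `ForgivenCollisions.closes` minus its last hypothesis): if the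
permanent family were a `VP` family over `ℂ`, `IsPComputable` gives `c` with
`L(per_n) ≤ n ^ c + c` for all `n`; `UniformLaw` at this `c` gives `r, n₀` with
`n₀ ^ c + c < κ_r(n₀) ≤ L(per_{n₀})` (`cosetComplexity_le_complexity`: `per_{n₀}` lies in its own
coset) — contradiction; so `¬ IsVPFamily (perPoly (Fin ·) ℂ)`, and the hub lemma
`Summit.ValiantsHypothesis.Hub.valiantsHypothesis_of_not_isVPFamily_per` with the bridge
`mem_VP_ofFintype_iff_holds` and Valiant's theorem `perFamily_mem_VNP_holds ℂ` gives `VP_ℂ ≠ VNP_ℂ`.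
Valiant 1979; Bürgisser 2000, Thm. 2.10. [folklore]
-/

-- `Summit.ValiantsHypothesis.ValiantsHypothesis.…` is the tree's mandated single-conjunct layout
-- (Sub = Summit), so the duplicated namespace component is intended.
set_option linter.dupNamespace false

namespace Summit.ValiantsHypothesis.ValiantsHypothesis.Theorems.ForgivenCollisions

/-- **Assembly** (item stmt-ValiantsHypothesis-11574 of route ForgivenCollisions):
`UniformLaw → GradedLaw → ⋯ → CoeffAgreement → ValiantsHypothesis`. Only `UniformLaw` is used:
a `VP` bound `L(per_n) ≤ n ^ c + c` contradicts `n₀ ^ c + c < κ_r(n₀) ≤ L(per_{n₀})`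
(`cosetComplexity_le_complexity`), and the hub lemma
`Summit.ValiantsHypothesis.Hub.valiantsHypothesis_of_not_isVPFamily_per` concludes. [folklore] -/
theorem assembly_proof :
    Summit.ValiantsHypothesis.ValiantsHypothesis.Theses.ForgivenCollisions.Assembly := by
  unfold Summit.ValiantsHypothesis.ValiantsHypothesis.Theses.ForgivenCollisions.Assembly
  intro hX _ _ _ _ _ _ _ _ _ _ _ _
  refine Summit.ValiantsHypothesis.Hub.valiantsHypothesis_of_not_isVPFamily_per ?_
    (Literature.Computability.AlgebraicComplexity.mem_VP_ofFintype_iff_holds _)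
    (Literature.Computability.AlgebraicComplexity.perFamily_mem_VNP_holds ℂ)
  rintro ⟨-, c, hc⟩
  obtain ⟨r, n₀, h⟩ := hX c
  exact absurd (hc n₀) (not_le.2 (lt_of_lt_of_le (h n₀ le_rfl)
    (Literature.Computability.AlgebraicComplexity.cosetComplexity_le_complexity _ _)))

end Summit.ValiantsHypothesis.ValiantsHypothesis.Theorems.ForgivenCollisions
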